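import Literature.NumberTheory.Automorphic.Liu2021.AppendixC.Glue
import Literature.AlgebraicGeometry.Motives.BaseChange
import Literature.AlgebraicGeometry.Motives.AbelianVarietyProjective
import HarnessLib

/-!
# Liu 2021 §2.1: formation of the Albanese variety `Alb_X` commutes with extension of the base field (named fact)

Topic `Literature/NumberTheory/Automorphic/Liu2021` (companion of `Liu2021/AlbaneseBaseChange`; consumed by
`Liu2021/AlbaneseBaseChangeProduct`).  ONE named fact (`def … : Prop`, D-0026 +1), nothing else.

[Liu2021] = Yifeng Liu, *Fourier–Jacobi cycles and arithmetic relative trace formula*, Camb. J. Math. **9** (2021) =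
arXiv:2102.11518; line numbers `l. NNNN` refer to the author's TeX source `FJcycle.tex` as in `Liu2021/AppendixC/Glue.lean`,
whose structure `AppendixC.Albanese X` (Def. 2.3 with the Proposition before it, l. 1190–1208: Liu's POINT-FREE Albanese
datum `α_X : ∇X → Alb_X` of a proper smooth `k`-scheme `X`, corepresenting `A ↦ {f : ∇X → A | ΔX ⊆ f⁻¹0_A}`) is the object.

## What is printed, and what this file records

* Proposition (l. 1190–1192) and its PROOF (l. 1194–1200): «Let `k'` be a separable closure of `k`. Then `k'` splits `X`
  […]. Put `X' := X_{k'}`. […] Pick an element `x ∈ X(π₀(X'))` […]. By Serre's construction [Ser59] of the Albanese variety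
  (see [Wit08, Appendix A] for a version over separably closed field), we have a morphism `g_x : X' → Alb_{X'}`, universal
  among all morphisms `g : X' → A` to an abelian variety `A` over `k'` such that `g(x) = 0_A`. Now it is easy to see that
  the composite morphism `∇_{k'}X' → Alb_{X'} ×_{k'} Alb_{X'} → Alb_{X'}` (difference) does not depend on the choice of `x`,
  and corepresents the functor `\underline{Alb}_{X'}`. […] As `(∇X)_{k'} ≃ ∇_{k'}X'`, the statement for `X` then follows by
  Galois descent.»  So `Alb_X` is CONSTRUCTED so that `(Alb_X)_{k'} = Alb_{X'}`.
* Lemma 2.2 (1) (l. 1211–1213, `k` of characteristic zero), PROOF (l. 1220–1228): «we pick an element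
  `x ∈ X(π₀(X ⊗_{k,τ} ℂ))`, which induces a morphism `(α_X)_x : X ⊗_{k,τ} ℂ → Alb_X ⊗_{k,τ} ℂ` […]. By the property of
  complex Albanese varieties, the induced map `(α_X)_x^*` […] is an isomorphism» — the silent use of: `Alb_X ⊗_{k,τ} ℂ` IS
  the Albanese variety of `X ⊗_{k,τ} ℂ`.
* The classical input behind both — the formation of the Albanese variety of a proper, geometrically connected and
  geometrically reduced scheme commutes with extension of the base field — is Grothendieck, FGA VI (Sém. Bourbaki 236),
  Thm. 3.3 (iii), in the form [AchterCasalainaMartinVial2026, Thm. 3.2 (Grothendieck–Conrad) and Rem. 3.3, pp. 807–808]: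
  «Let `V` be a proper geometrically connected and geometrically reduced scheme over a field `K`. Then Albanese data for
  `V` is stable under base change of field».

This file records the resulting ONE-SENTENCE COMPARISON statement in Liu's `∇`-language, `albanese_baseChange`: for
`σ : k →+* L` (`k` of characteristic zero, `L` algebraically closed), a proper smooth `X/k`, ANY Liu Albanese datum `a` of `X`
and ANY Liu Albanese datum `a'` of `X ⊗_{k,σ} L`, `a'.Alb ≅ a.Alb ⊗_{k,σ} L` — «the Albanese variety of `X_L` is the base change
of the Albanese variety of `X`».  It asserts NO existence: Albanese data of `X ⊗_{k,σ} L` are CONSTRUCTED in the tree from a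
decomposition into geometrically irreducible pieces with Albanese data (`Liu2021/AlbaneseOfPieces`,
`AppendixC.Albanese.nonempty_of_isColimit`), and Liu's Proposition itself is the separate fact `Liu2021.exists_albanese`
(`Liu2021/AlbaneseBaseChange`).

RELATION TO `Liu2021/AlbaneseBaseChange.lean` (TEAM hComp referee ruling R-3; red-team audit «composite cited fact»):
the fact `albanese_baseChange_isLimit_fan_jacobian` recorded there was assembled from (a) the printed proof above,
(i) uniqueness of Albanese data, (ii) Grothendieck's base-change theorem, (iii) pointed versus point-free Albanese and the
product decomposition over the connected components of `X ⊗_{k,σ} L`.  Clauses (i) and (iii) are now THEOREMS of the tree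
(`Liu2021/NablaOfPieces`: `AppendixC.Albanese.nonempty_iso`; `Liu2021/AlbaneseOfPieces`:
`AppendixC.Albanese.nonempty_of_isColimit`; `Liu2021/AlbaneseBaseChangeProduct`:
`AppendixC.Albanese.exists_isLimit_fan_of_isColimit`), and `albanese_baseChange_isLimit_fan_jacobian` is DERIVED from the
present fact (`albanese_baseChange_isLimit_fan_jacobian_of_albanese_baseChange`, file `Liu2021/AlbaneseBaseChangeProduct`).
The present fact is (a)+(ii) and nothing else.  Nothing is asserted; no instance, no `variable`.

## References

* [Liu2021] Y. Liu, arXiv:2102.11518 = Camb. J. Math. 9 (2021): §2.1 Proposition (l. 1190–1192) with proof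
  (l. 1194–1200), Def. 2.3 (l. 1202–1208), Lemma 2.2 (1) (l. 1211–1213) with proof (l. 1220–1228).
* [AchterCasalainaMartinVial2026] J. D. Achter, S. Casalaina-Martin, Ch. Vial, *A complete answer to Albanese base change for
  incomplete varieties*, Ann. Inst. Fourier 76 (2026) no. 2, 789–828 (= arXiv:2210.05017): Thm. 3.2 (Grothendieck–Conrad),
  Rem. 3.3 (pp. 807–808).
* [Grothendieck1962FGA6] A. Grothendieck, *TDTE VI: les schémas de Picard, propriétés générales* (Sém. Bourbaki 236, 1962),
  Thm. 3.3 (iii) (locator through [AchterCasalainaMartinVial2026, Rem. 3.3]; text not held).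
* [GortzWedhorn2023] U. Görtz, T. Wedhorn, *Algebraic Geometry II* (2023), Remark 27.221, Remark 27.225, pp. 908–909
  (`Alb = (Pic⁰)^∨` in characteristic `0`; the Picard scheme and duality commute with base change).
* [Serre1958MorphismesUniversels] J.-P. Serre, *Morphismes universels et variété d'Albanese*, Sém. Chevalley 4 (1958/59),
  exp. 10; [Wittenberg2008AlbaneseTorsors] O. Wittenberg, Math. Ann. 340 (2008), Appendix A — the references OF the
  printed proof.
-/

noncomputable section

open CategoryTheory AlgebraicGeometry
open Literature.AlgebraicGeometry.Motives

namespace Literature.NumberTheory.Automorphic.Liu2021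

/-- **[Liu2021, §2.1] Formation of the Albanese variety commutes with extension of the base field.**  For a field `k` of
characteristic zero, a ring homomorphism `σ : k →+* L` into an algebraically closed field `L`, a proper smooth `k`-scheme
`X`, and ANY Albanese datum `a` of `X` in the sense of Def. 2.3 (`α_X : ∇X → Alb_X` corepresenting
`A ↦ {f : ∇X → A | ΔX ⊆ f⁻¹0_A}`; the Proposition, l. 1190–1192) and ANY Albanese datum `a'` of `X ⊗_{k,σ} L` (Def. 2.3 over
`L`), the base change `Alb_X ⊗_{k,σ} L` IS the Albanese variety of `X ⊗_{k,σ} L`: `a'.Alb ≅ Alb_X ⊗_{k,σ} L` as abelian varieties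
over `L`.  A COMPARISON statement: it asserts no existence (vacuous where no datum exists; Albanese data of `X ⊗_{k,σ} L` are
constructed in the tree, `AppendixC.Albanese.nonempty_of_isColimit`, file `Liu2021/AlbaneseOfPieces`; Liu's Proposition is the
separate fact `exists_albanese`).  SOURCE MAP (the two clauses, separated): (a) PRINTED, proof of the Proposition, l. 1194–1200:
for a separable closure `k'` of `k` (which splits `X`), `Alb_{X'}`, `X' = X_{k'} = ⊔ᵢ Xᵢ`, is corepresented through the
difference map by Serre's Albanese of `X'` pointed at one point per connected component (`= ∏ᵢ Alb_{Xᵢ}`), and «as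
`(∇X)_{k'} ≃ ∇_{k'}X'`, the statement for `X` then follows by Galois descent» — `Alb_X` is CONSTRUCTED with
`(Alb_X)_{k'} ≅ Alb_{X'}`; since a corepresenting object is unique up to isomorphism (tree theorem
`AppendixC.Albanese.nonempty_iso`, file `Liu2021/NablaOfPieces`) this holds for every datum `a`; (ii) NOT PRINTED in
[Liu2021] (used silently in the proof of Lemma 2.2 (1), l. 1220–1228: «`(α_X)_x : X ⊗_{k,τ} ℂ → Alb_X ⊗_{k,τ} ℂ` […] By the
property of complex Albanese varieties, the induced map `(α_X)_x^*` […] is an isomorphism»): for each geometrically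
connected proper smooth `Xᵢ / k'` and the extension `k' → L` over `σ`, `Alb_{Xᵢ} ⊗_{k'} L` is the Albanese variety of
`Xᵢ ⊗_{k'} L` — Grothendieck, FGA VI Thm. 3.3 (iii) (`Alb = (Pic⁰_red)^∨` and base change of the Picard scheme), in the
form [AchterCasalainaMartinVial2026, Thm. 3.2 (Grothendieck–Conrad) with Rem. 3.3]: «Let `V` be a proper geometrically
connected and geometrically reduced scheme over a field `K`. Then Albanese data for `V` is stable under base change of
field» (in characteristic `0` also [GortzWedhorn2023, Remark 27.225 and pp. 908–909]); the `Xᵢ ⊗_{k'} L` are the connected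
components of `X ⊗_{k,σ} L`, over which Liu's functor splits as a product (tree theorem
`AppendixC.Albanese.exists_isLimit_fan_of_isColimit`, file `Liu2021/AlbaneseBaseChangeProduct`), so `∏ᵢ Alb_{Xᵢ ⊗_{k'} L}`
with the difference maps is an Albanese datum of `X ⊗_{k,σ} L` with variety `≅ (∏ᵢ Alb_{Xᵢ}) ⊗_{k'} L ≅ Alb_X ⊗_{k,σ} L`, and
ANY datum `a'` has `a'.Alb` isomorphic to it (uniqueness, `AppendixC.Albanese.nonempty_iso`).
STATUS: a cited theorem = (a)+(ii); DERIVED in the sense that [Liu2021] prints (a) and uses (ii) without statement.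
WEAKER than print: only `L` algebraically closed, only `k` of characteristic zero (the consumer's `L = ℂ`), only the
isomorphism class of the abelian variety `Alb_{X_L}` (not the compatibility of `α` with `(∇X)_L ≃ ∇(X_L)`), and no existence
clause.  NOT part of this fact (they are tree theorems): existence of the Albanese datum of a split scheme
(`AppendixC.Albanese.nonempty_of_isColimit`); uniqueness of Albanese data; pointed versus point-free Albanese (Milne,
*Jacobian Varieties*, Prop. 6.1 ⇔ 6.4); the product decomposition `Alb_{∐ Y_c} = ∏ Alb_{Y_c}`; the existence of Albanese data
of the complex pieces (`Motives.nonempty_jacobian_of_isSmoothProjective_complex_of_dim`).  The composite fact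
`albanese_baseChange_isLimit_fan_jacobian` (`Liu2021/AlbaneseBaseChange`) follows from this one
(`albanese_baseChange_isLimit_fan_jacobian_of_albanese_baseChange`, `Liu2021/AlbaneseBaseChangeProduct`).  Nothing is
asserted; a consumer takes `(h : albanese_baseChange)`.
[cite: Liu2021, §2.1 Proposition (FJcycle.tex l. 1190–1192) with proof (l. 1194–1200), Def. 2.3 (l. 1202–1208), Lemma 2.2 (1) (l. 1211–1213, proof l. 1220–1228)]
[cite: AchterCasalainaMartinVial2026, Thm. 3.2 and Rem. 3.3 (pp. 807–808)]
[cite: Grothendieck1962FGA6, Thm. 3.3 (iii)] [cite: GortzWedhorn2023, Remark 27.225 and pp. 908–909] -/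
def albanese_baseChange : Prop :=
  ∀ (k L : Type) [Field k] [CharZero k] [Field L] [IsAlgClosed L] (σ : k →+* L) (X : SchemeOver k),
    AlgebraicGeometry.IsProper X.hom → AlgebraicGeometry.Smooth X.hom →
    ∀ (a : AppendixC.Albanese X) (a' : AppendixC.Albanese ((baseChangeHom σ).obj X)),
      Nonempty (a'.Alb ≅ (letI := σ.toAlgebra; a.Alb.baseChange L))

end Literature.NumberTheory.Automorphic.Liu2021

end
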